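import Literature.MathematicalPhysics.QuantumChemistry.ThreeIndexConditionsTwoRDM
import HarnessLib

/-!
# The `T2′` condition: positivity for every state and its blocks as functionals of the 1- and 2-RDM

Topic `Literature/MathematicalPhysics/QuantumChemistry`; continues `ThreeIndexConditionsTwoRDM.lean`
(`T1`, `T2` in anticommutator form). The `T2′` condition of Braams–Percus–Zhao (equivalently
Mazziotti's `T̄2` restricted to a fixed particle number), as printed by Nakata et al. (2008) §II.B, is
the positive semidefiniteness of the block matrix

  `T2′ = ( T2  X ; X†  γ )`,

indexed by the triples `(i,j,k)` of `C_I = a†_i a†_j a_k` together with the single indices `l` of the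
creators `a†_l`: the `T2` block is the anticommutator-form `T2` matrix, `X_{(ijk), l} =
⟨ψ| a†_i a†_j a_k a_l |ψ⟩` is a 2-RDM entry and the corner is the 1-RDM `γ_{kl} = ⟨ψ| a†_k a_l |ψ⟩`
("This matrix has `T2`-matrix and the 1-RDM `γ` at the diagonal"). It is "obtained by slightly
strengthening `T2`": for `O = Σ_I b_I C_I + Σ_l d_l a†_l` and its cubic part `Õ = Σ_I b_I C_I` one has
`‖O† ψ‖² + ‖Õ ψ‖² ≥ 0`, and this quadratic form in `(b, d)` is exactly `T2′` — the six-operator parts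
cancel inside the `T2` block (`twoCreateAnnihilate_anticomm_eq`) and the linear part only rides with
ONE of the two orderings, which is what makes every block a functional of the 2-RDM.

In the tree's vocabulary (no new definitions): with the operator family
`C′ = Sum.elim twoCreateAnnihilate creation : (ι × ι × ι) ⊕ ι → Op` and the partial adjoint family
`C″ = Sum.elim (fun t => (twoCreateAnnihilate t)ᴴ) 0`, the `T2′` matrix is
`metricMatrix C′ ψ + (metricMatrix C″ ψ)ᵀ`. This file PROVES: it is positive semidefinite for every
Fock-space vector `ψ` (`t2Prime_posSemidef`: Gram + transpose of Gram,
`metricMatrix_add_transpose_conjTranspose_posSemidef` pattern), and identifies its four blocks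
(`t2Prime_apply_inl_inl` = the `T2` matrix of `ThreeIndexConditionsTwoRDM.lean`, hence a 2-RDM
functional by `t2_entry_eq_rdm`; `t2Prime_apply_inl_inr`, `t2Prime_apply_inr_inl` = `twoRDM` entries;
`t2Prime_apply_inr_inr` = `oneRDM`). Hence `T2′ ⪰ 0` is a necessary `N`-representability condition
expressible on `(¹D, ²D)` — the strongest condition of the `PQGT1T2′` hierarchy
`E_PQG ≤ E_PQGT1 ≤ E_PQGT1T2 ≤ E_PQGT1T2′ ≤ E_fullCI` (Nakata et al. (2008) §II.C). `T2′ ⪰ 0` implies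
`T2 ⪰ 0` (principal `Sum.inl` block: `(t2Prime_posSemidef ψ).submatrix Sum.inl` is, entry by entry
(`rfl`), the matrix of `t2Anticomm_posSemidef`). 0 sorry, no definitions, no named facts.

What is NOT here: Mazziotti's larger `T̄2` metric matrix (`t2BarMatrix` of `PositivityConditions.lean`,
the operator set `{a†_i, a_i, a†a†a + a a a†}`) and its fixed-`N` block decomposition into `T2′`-type
blocks; spin adaptation; sufficiency questions.

## References
* M. Nakata, B. J. Braams, K. Fujisawa, M. Fukuda, J. K. Percus, M. Yamashita, Z. Zhao, J. Chem. Phys.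
  128 (2008) 164113, §II.B (`T2′ = (T2 X; X† γ)`, "obtained by slightly strengthening `T2`";
  `A†A + AA†`), §II.C (the energy inequalities). [cite: NakataEtAl2008, §II.B]
* B. J. Braams, J. K. Percus, Z. Zhao, *The T1 and T2 representability conditions*, Adv. Chem. Phys.
  134 (2007) 93–101 (the `T2′` condition) and D. A. Mazziotti, ibid. 21–59, eq. (45) (`T̄2`) — cited
  through Nakata et al. (2008) refs. 28–29. [cite: Mazziotti2007RDMChapter, §II.D.2 eq. (45)]
-/

noncomputable section

namespace Literature.MathematicalPhysics.QuantumChemistry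

open Matrix Literature.MathematicalPhysics.QuantumLattice
open scoped ComplexOrder

variable {ι : Type*} [LinearOrder ι] [Fintype ι]

/-- **The `T2′` condition holds for every state.** For the operator family
`C′ = (a†_i a†_j a_k)_{(ijk)} ⊔ (a†_l)_l` and the partial adjoint family `C″ = ((a†_i a†_j a_k)†) ⊔ 0`,
the `T2′` matrix `M(C′) + M(C″)ᵀ = ( T2 X ; X† γ )` is positive semidefinite for every Fock-space
vector `ψ`: `M(C′)` is the Gram matrix of the vectors `C′† ψ` and `M(C″)ᵀ` the transpose of the Gram
matrix of the vectors `C_I ψ` (padded by zeros), i.e. `b̄ᵀ T2′ b̄ = ‖O†ψ‖² + ‖Õψ‖² ≥ 0` for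
`O = Σ b_I C_I + Σ d_l a†_l`, `Õ` its cubic part. Nakata et al. (2008) §II.B (Braams–Percus–Zhao's `T2′`,
Mazziotti's `T̄2`). [cite: NakataEtAl2008, §II.B] -/
theorem t2Prime_posSemidef (ψ : Fock ι) :
    (metricMatrix (Sum.elim twoCreateAnnihilate creation) ψ +
      (metricMatrix (Sum.elim (fun t : ι × ι × ι => (twoCreateAnnihilate t)ᴴ)
        (0 : ι → Matrix (Finset ι) (Finset ι) ℂ)) ψ)ᵀ).PosSemidef :=
  (metricMatrix_posSemidef _ ψ).add (metricMatrix_posSemidef _ ψ).transpose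

/-- **The `T2` block of `T2′`** is the anticommutator-form `T2` matrix
`⟨ψ| C_I C_J† + C_J† C_I |ψ⟩` of `ThreeIndexConditionsTwoRDM.lean` (hence the 2-RDM functional of
`t2_entry_eq_rdm`). Nakata et al. (2008) §II.B ("this matrix has `T2`-matrix … at the diagonal").
[cite: NakataEtAl2008, §II.B] -/
theorem t2Prime_apply_inl_inl (ψ : Fock ι) (I J : ι × ι × ι) :
    (metricMatrix (Sum.elim twoCreateAnnihilate creation) ψ +
        (metricMatrix (Sum.elim (fun t : ι × ι × ι => (twoCreateAnnihilate t)ᴴ)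
          (0 : ι → Matrix (Finset ι) (Finset ι) ℂ)) ψ)ᵀ) (Sum.inl I) (Sum.inl J) =
      (metricMatrix twoCreateAnnihilate ψ +
        (metricMatrix (fun t : ι × ι × ι => (twoCreateAnnihilate t)ᴴ) ψ)ᵀ) I J := by
  rfl

/-- The `T2` block of `T2′`, entrywise, as the explicit functional of `oneRDM ψ`, `twoRDM ψ` of
`t2_entry_eq_rdm`. Nakata et al. (2008) §II.A–B. [cite: NakataEtAl2008, §II.B] -/
theorem t2Prime_apply_inl_inl_eq_rdm (ψ : Fock ι) (i j k l m n : ι) :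
    (metricMatrix (Sum.elim twoCreateAnnihilate creation) ψ +
        (metricMatrix (Sum.elim (fun t : ι × ι × ι => (twoCreateAnnihilate t)ᴴ)
          (0 : ι → Matrix (Finset ι) (Finset ι) ℂ)) ψ)ᵀ) (Sum.inl (i, j, k)) (Sum.inl (l, m, n)) =
      (if k = n then (1 : ℂ) else 0) * twoRDM ψ (i, j) (l, m)
      - (if l = i then (1 : ℂ) else 0) * twoRDM ψ (n, j) (k, m)
      + (if l = j then (1 : ℂ) else 0) * twoRDM ψ (n, i) (k, m)
      + (if m = i then (1 : ℂ) else 0) * twoRDM ψ (n, j) (k, l)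
      - (if m = j then (1 : ℂ) else 0) * twoRDM ψ (n, i) (k, l)
      + (if l = i then (1 : ℂ) else 0) * (if m = j then (1 : ℂ) else 0) * oneRDM ψ n k
      - (if l = j then (1 : ℂ) else 0) * (if m = i then (1 : ℂ) else 0) * oneRDM ψ n k := by
  rw [t2Prime_apply_inl_inl, t2_entry_eq_rdm]

/-- **The off-diagonal block `X` of `T2′`** is a 2-RDM entry:
`T2′_{(ijk), l} = ⟨ψ| a†_i a†_j a_k a_l |ψ⟩ = ²D^{ij}_{lk}` (`= twoRDM ψ (i, j) (l, k)`).
Nakata et al. (2008) §II.B (the block `X` expressed through `Γ`). [cite: NakataEtAl2008, §II.B] -/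
theorem t2Prime_apply_inl_inr (ψ : Fock ι) (i j k l : ι) :
    (metricMatrix (Sum.elim twoCreateAnnihilate creation) ψ +
        (metricMatrix (Sum.elim (fun t : ι × ι × ι => (twoCreateAnnihilate t)ᴴ)
          (0 : ι → Matrix (Finset ι) (Finset ι) ℂ)) ψ)ᵀ) (Sum.inl (i, j, k)) (Sum.inr l) =
      twoRDM ψ (i, j) (l, k) := by
  simp only [Matrix.add_apply, Matrix.transpose_apply, metricMatrix, Sum.elim_inl, Sum.elim_inr,
    Pi.zero_apply, Matrix.zero_mul, zero_mulVec, dotProduct_zero, add_zero, twoRDM,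
    twoCreateAnnihilate, creation_conjTranspose]

/-- **The block `X†` of `T2′`**: `T2′_{l, (ijk)} = ⟨ψ| a†_l a†_k a_j a_i |ψ⟩ = ²D^{lk}_{ij}`
(`= twoRDM ψ (l, k) (i, j)`). Nakata et al. (2008) §II.B. [cite: NakataEtAl2008, §II.B] -/
theorem t2Prime_apply_inr_inl (ψ : Fock ι) (l i j k : ι) :
    (metricMatrix (Sum.elim twoCreateAnnihilate creation) ψ +
        (metricMatrix (Sum.elim (fun t : ι × ι × ι => (twoCreateAnnihilate t)ᴴ)
          (0 : ι → Matrix (Finset ι) (Finset ι) ℂ)) ψ)ᵀ) (Sum.inr l) (Sum.inl (i, j, k)) =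
      twoRDM ψ (l, k) (i, j) := by
  simp only [Matrix.add_apply, Matrix.transpose_apply, metricMatrix, Sum.elim_inl, Sum.elim_inr,
    Pi.zero_apply, conjTranspose_zero, Matrix.mul_zero, zero_mulVec, dotProduct_zero, add_zero,
    twoRDM, twoCreateAnnihilate, conjTranspose_mul, creation_conjTranspose, annihilation_conjTranspose,
    ← Matrix.mul_assoc]

/-- **The corner block of `T2′` is the 1-RDM**: `T2′_{kl} = ⟨ψ| a†_k a_l |ψ⟩ = γ_{kl} = oneRDM ψ k l`.
Nakata et al. (2008) §II.B ("`(T2′)_{kl} = γ_{kl}`"). [cite: NakataEtAl2008, §II.B] -/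
theorem t2Prime_apply_inr_inr (ψ : Fock ι) (k l : ι) :
    (metricMatrix (Sum.elim twoCreateAnnihilate creation) ψ +
        (metricMatrix (Sum.elim (fun t : ι × ι × ι => (twoCreateAnnihilate t)ᴴ)
          (0 : ι → Matrix (Finset ι) (Finset ι) ℂ)) ψ)ᵀ) (Sum.inr k) (Sum.inr l) =
      oneRDM ψ k l := by
  simp only [Matrix.add_apply, Matrix.transpose_apply, metricMatrix, Sum.elim_inr, Pi.zero_apply,
    Matrix.zero_mul, zero_mulVec, dotProduct_zero, add_zero, oneRDM, creation_conjTranspose]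

end Literature.MathematicalPhysics.QuantumChemistry

end
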